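import Mathlib
import HarnessLib
import Literature.MathematicalPhysics.QuantumLattice.HubbardUVBandPieces
import Summits.HubbardSuperconductivity.HubbardSuperconductivity.Theorems.KLProgrammeKLRegimeEngineScaleZeroDecay
import Summits.HubbardSuperconductivity.HubbardSuperconductivity.Theorems.KLProgrammeKLRegimeSplitEvalDerivBounds
import Summits.HubbardSuperconductivity.HubbardSuperconductivity.Theorems.KLProgrammeKLRegimeSplitCounterMap
import Summits.HubbardSuperconductivity.HubbardSuperconductivity.Theorems.KLProgrammeKLRegimeEngineFrameLevelCount

/-!
# Route `KLProgramme`, crux K3 child ENGINE (`KLRegimeEngineV14`, stmt-HubbardSuperconductivity-19918), stub `stub_engine_scale0`,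
# conjunct (E4)₀: the PARTIAL FRAME BANDS `bₘ = e_0 − Σ_{n<m} Kₙ` of an admissible frame (`FrameOK`) — periodicity, smoothness, the
# one-scale derivative bounds `‖Dⁱ(bₘ + s·(−Kₘ))‖ ≤ (D_c·2ᵐ)ⁱ` (`i ≤ 3`), the piece bounds `‖DⁱKₘ‖ ≤ Gfr i·u_i(U)·Yₘ^{2i}/Yₘ⁴`
# (`Yₘ = 2ᵐ`), and the identification of the last band with `e_K`

Cell gate-hubbard-kl, seat hubbard-kl-k3c2-p1 g3 (the space part `A_X` of the weighted decay constant `α_w` of (E4)₀, design of record).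
The first space moment of the scale-`0` covariance needs THIRD lattice differences of `Ψ(ω, e_K(·))`, and `‖D³e_K‖ ≍ Gfr₃U²4^{N}` is not
uniform in the number of scales; the remedy (Benfatto–Giuliani–Mastropietro 2006, §3 (3.2)–(3.8)) is to telescope the symbol along the
partial frames `bₘ`, `m = 0, …, N+1` (`b₀ = e − μ` the bare band, `b_{N+1} = e_K`), each increment being small at its own scale.  This
file supplies the band-side inputs of `Literature.HubbardUVBandPieces.spaceMoment_basePiece_le / spaceMoment_incrPiece_le`:

* `frameBandSeq_periodic`, `contDiff_frameBandSeq`, `frameBandSeq_last_eq_frameLevel`, `nambuXiCT_eq_frameBandSeq_last` — the family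
  `bₘ(q) = frameLevel μ 0 q − Σ_{n<m} evalM (Kp n) q`;
* `norm_iteratedFDeriv_frameLevel_zero_le` (`‖Dⁱ(e − μ)‖ ≤ 4`, `i ≥ 1`), `four_zpow_eq_two_pow_div`
  (`4^{(i-2)m} = (2ᵐ)^{2i}/(2ᵐ)⁴`), `norm_iteratedFDeriv_framePiece_le` (the `FrameOK` piece bound in that form);
* **`norm_iteratedFDeriv_frameBandInterp_le`** — `‖Dⁱ(bₘ + s·(−Kₘ))(q)‖ ≤ (D_c·2ᵐ)ⁱ` for `1 ≤ i ≤ 3`, `s ∈ [0,1]`, `m ≤ N`, `|U| ≤ 1`,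
  `D_c = 4 + (4/3)(Gfr 1 + Gfr 2 + Gfr 3)`; `norm_iteratedFDeriv_frameLevel_zero_le_pow` (the bare band: `≤ 4ⁱ`).
-/

noncomputable section

namespace Summit.HubbardSuperconductivity.HubbardSuperconductivity.Theorems.EngineV8

set_option linter.dupNamespace false -- summit = problem name (single-conjunct summit), D-0017

open Real Finset Literature.MathematicalPhysics.QuantumLattice Literature.Probability.LatticeModels
open Summit.HubbardSuperconductivity.HubbardSuperconductivity.Theorems.KLRegimeSplit
open Summit.HubbardSuperconductivity.HubbardSuperconductivity.Theorems.DispersionFlow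
open Summit.HubbardSuperconductivity.HubbardSuperconductivity.Theorems.ScaleZeroDecay

variable {L : ℕ}

/-! ## §1 The partial frame bands -/

/-- **Periodicity of the partial bands** `bₘ = frameLevel μ 0 − Σ_{n<m} evalM (Kp n)` on the momentum plane. -/
theorem frameBandSeq_periodic (μ : ℝ) (Kp : ℕ → TrigPolyC4v) (m : ℕ) (p : Fin 2 → ℝ) (z : Fin 2 → ℤ) :
    (fun q : EuclideanSpace ℝ (Fin 2) => frameLevel μ 0 q - ∑ n ∈ range m, evalM (Kp n) q)
        (WithLp.toLp 2 (fun i => p i + z i * (2 * Real.pi))) =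
      (fun q : EuclideanSpace ℝ (Fin 2) => frameLevel μ 0 q - ∑ n ∈ range m, evalM (Kp n) q) (WithLp.toLp 2 p) := by
  simp only [frameLevel_toLp_eq_ctBandFn, ctBandFn_periodic, evalM, TrigPolyC4v.eval_periodic]

/-- **Periodicity of a frame piece.** -/
theorem evalM_neg_periodic (A : TrigPolyC4v) (p : Fin 2 → ℝ) (z : Fin 2 → ℤ) :
    (fun q : EuclideanSpace ℝ (Fin 2) => -evalM A q) (WithLp.toLp 2 (fun i => p i + z i * (2 * Real.pi))) =
      (fun q : EuclideanSpace ℝ (Fin 2) => -evalM A q) (WithLp.toLp 2 p) := by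
  simp only [evalM, TrigPolyC4v.eval_periodic]

/-- **The partial bands are smooth.** -/
theorem contDiff_frameBandSeq (μ : ℝ) (Kp : ℕ → TrigPolyC4v) (m : ℕ) {k : WithTop ℕ∞} :
    ContDiff ℝ k (fun q : EuclideanSpace ℝ (Fin 2) => frameLevel μ 0 q - ∑ n ∈ range m, evalM (Kp n) q) :=
  (contDiff_frameLevel μ 0).sub (ContDiff.sum fun n _ => contDiff_evalM (Kp n))

/-- **A frame piece is smooth.** -/
theorem contDiff_evalM_neg (A : TrigPolyC4v) {k : WithTop ℕ∞} : ContDiff ℝ k (fun q : EuclideanSpace ℝ (Fin 2) => -evalM A q) :=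
  (contDiff_evalM A).neg

/-- **The last partial band is the frame band**: under the piece decomposition of `FrameOK`, `b_{N+1} = e_K`. -/
theorem frameBandSeq_last_eq_frameLevel (μ : ℝ) {K : TrigPolyC4v} {Kp : ℕ → TrigPolyC4v} {N : ℕ}
    (hsum : ∀ p : Fin 2 → ℝ, K.eval p = ∑ n ∈ range (N + 1), (Kp n).eval p) (q : EuclideanSpace ℝ (Fin 2)) :
    frameLevel μ 0 q - ∑ n ∈ range (N + 1), evalM (Kp n) q = frameLevel μ K q := by
  simp only [frameLevel, evalM, TrigPolyC4v.eval_zero, hsum, sub_zero]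

/-- **The lattice band `e_K` on the dual torus samples the last partial band.** -/
theorem nambuXiCT_eq_frameBandSeq_last [NeZero L] (μ : ℝ) {K : TrigPolyC4v} {Kp : ℕ → TrigPolyC4v} {N : ℕ}
    (hsum : ∀ p : Fin 2 → ℝ, K.eval p = ∑ n ∈ range (N + 1), (Kp n).eval p) :
    nambuXiCT L μ K = fun y : TorusSite 2 L =>
      (fun q : EuclideanSpace ℝ (Fin 2) => frameLevel μ 0 q - ∑ n ∈ range (N + 1), evalM (Kp n) q)
        (WithLp.toLp 2 (latticeMomentum L y)) := by
  funext y
  show nambuXiCT L μ K y = frameLevel μ 0 (WithLp.toLp 2 (latticeMomentum L y)) -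
    ∑ n ∈ range (N + 1), evalM (Kp n) (WithLp.toLp 2 (latticeMomentum L y))
  rw [frameBandSeq_last_eq_frameLevel μ hsum, frameLevel_toLp_eq_ctBandFn, nambuXiCT_eq_ctBandFn]

/-- **The increment of the partial bands**: `b_{m+1} = bₘ + (−Kₘ)` pointwise. -/
theorem frameBandSeq_succ (μ : ℝ) (Kp : ℕ → TrigPolyC4v) (m : ℕ) (q : EuclideanSpace ℝ (Fin 2)) :
    frameLevel μ 0 q - ∑ n ∈ range (m + 1), evalM (Kp n) q =
      (frameLevel μ 0 q - ∑ n ∈ range m, evalM (Kp n) q) + -evalM (Kp m) q := by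
  rw [sum_range_succ]; ring

/-! ## §2 Derivative bounds -/

/-- **`‖Dⁱ(e − μ)‖ ≤ 4` for `i ≥ 1`**: the bare band `frameLevel μ 0 = −2(cos q₀ + cos q₁) − μ`. -/
theorem norm_iteratedFDeriv_frameLevel_zero_le (μ : ℝ) {i : ℕ} (hi : 1 ≤ i) (q : Momentum) :
    ‖iteratedFDeriv ℝ i (frameLevel μ 0) q‖ ≤ 4 := by
  have hc : ∀ l : Fin 2, ContDiff ℝ i (fun q : Momentum => Real.cos ((1 : ℕ) * (WithLp.ofLp q) l)) :=
    fun l => contDiff_cos_coord 1 l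
  have hfun : frameLevel μ 0 = fun q : Momentum => (-2 : ℝ) • Real.cos ((1 : ℕ) * (WithLp.ofLp q) 0) +
      ((-2 : ℝ) • Real.cos ((1 : ℕ) * (WithLp.ofLp q) 1) + -μ) := by
    funext q
    simp only [frameLevel, squareDispersion, TrigPolyC4v.eval_zero, smul_eq_mul, Nat.cast_one, one_mul]
    ring
  have hi0 : i ≠ 0 := by omega
  have hs0 : ContDiff ℝ i (fun q : Momentum => (-2 : ℝ) • Real.cos ((1 : ℕ) * (WithLp.ofLp q) 0)) := (hc 0).const_smul _
  have hs1 : ContDiff ℝ i (fun q : Momentum => (-2 : ℝ) • Real.cos ((1 : ℕ) * (WithLp.ofLp q) 1)) := (hc 1).const_smul _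
  have hK : ContDiff ℝ i (fun _ : Momentum => -μ) := contDiff_const
  have hg : ContDiff ℝ i (fun q : Momentum => (-2 : ℝ) • Real.cos ((1 : ℕ) * (WithLp.ofLp q) 1) + -μ) := hs1.add hK
  rw [hfun, fun_iteratedFDeriv_add_apply hs0.contDiffAt hg.contDiffAt, fun_iteratedFDeriv_add_apply hs1.contDiffAt hK.contDiffAt,
    iteratedFDeriv_const_smul_apply' (hc 0).contDiffAt, iteratedFDeriv_const_smul_apply' (hc 1).contDiffAt,
    iteratedFDeriv_const_of_ne hi0, Pi.zero_apply, add_zero]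
  have h0 : ‖iteratedFDeriv ℝ i (fun q : Momentum => Real.cos ((1 : ℕ) * (WithLp.ofLp q) 0)) q‖ ≤ 1 := by
    simpa using norm_iteratedFDeriv_cos_coord_le 1 0 i q
  have h1 : ‖iteratedFDeriv ℝ i (fun q : Momentum => Real.cos ((1 : ℕ) * (WithLp.ofLp q) 1)) q‖ ≤ 1 := by
    simpa using norm_iteratedFDeriv_cos_coord_le 1 1 i q
  calc _ ≤ ‖(-2 : ℝ) • iteratedFDeriv ℝ i (fun q : Momentum => Real.cos ((1 : ℕ) * (WithLp.ofLp q) 0)) q‖ +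
        ‖(-2 : ℝ) • iteratedFDeriv ℝ i (fun q : Momentum => Real.cos ((1 : ℕ) * (WithLp.ofLp q) 1)) q‖ := norm_add_le _ _
    _ ≤ 2 * 1 + 2 * 1 := by
        rw [norm_smul, norm_smul, Real.norm_eq_abs, abs_neg, abs_two]
        exact add_le_add (mul_le_mul_of_nonneg_left h0 zero_le_two) (mul_le_mul_of_nonneg_left h1 zero_le_two)
    _ = 4 := by norm_num

/-- The bare band in the one-scale form: `‖Dⁱ(e − μ)‖ ≤ 4ⁱ` for `1 ≤ i`. -/
theorem norm_iteratedFDeriv_frameLevel_zero_le_pow (μ : ℝ) {i : ℕ} (hi : 1 ≤ i) (q : Momentum) :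
    ‖iteratedFDeriv ℝ i (frameLevel μ 0) q‖ ≤ (4 : ℝ) ^ i :=
  (norm_iteratedFDeriv_frameLevel_zero_le μ hi q).trans (by
    calc (4 : ℝ) = 4 ^ 1 := (pow_one _).symm
      _ ≤ 4 ^ i := pow_le_pow_right₀ (by norm_num) hi)

/-- **`4^{(i-2)m} = Yₘ^{2i}/Yₘ⁴`**, `Yₘ = 2ᵐ` (the piece exponents of `FrameOK` in one-scale form). -/
theorem four_zpow_eq_two_pow_div (i m : ℕ) :
    (4 : ℝ) ^ (((i : ℤ) - 2) * m) = ((2 : ℝ) ^ m) ^ (2 * i) / ((2 : ℝ) ^ m) ^ 4 := by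
  have h2 : (2 : ℝ) ^ m ≠ 0 := by positivity
  rw [show (4 : ℝ) = 2 ^ ((2 : ℕ) : ℤ) by norm_num, ← zpow_mul, show ((2 : ℕ) : ℤ) * (((i : ℤ) - 2) * m) =
    ((2 * i * m : ℕ) : ℤ) - ((4 * m : ℕ) : ℤ) by push_cast; ring, zpow_sub₀ (by norm_num : (2 : ℝ) ≠ 0), zpow_natCast, zpow_natCast,
    ← pow_mul, ← pow_mul]
  congr 1 <;> ring

/-- **The `FrameOK` piece bound in one-scale form**: `‖Dⁱ(−Kₘ)(q)‖ ≤ Gfr i·u_i(U)·Yₘ^{2i}/Yₘ⁴` (`m ≤ N`, `i ≤ 4`). -/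
theorem norm_iteratedFDeriv_framePiece_le {R : RenConsts} {U : ℝ} {N : ℕ} {Kp : ℕ → TrigPolyC4v}
    (hS : ∀ n ≤ N, ∀ j ≤ 4, ∀ q : Momentum, ‖iteratedFDeriv ℝ j (evalM (Kp n)) q‖ ≤ R.Gfr j * uPow j U * (4 : ℝ) ^ (((j : ℤ) - 2) * n))
    {m : ℕ} (hm : m ≤ N) {i : ℕ} (hi : i ≤ 4) (q : Momentum) :
    ‖iteratedFDeriv ℝ i (fun q : Momentum => -evalM (Kp m) q) q‖ ≤ R.Gfr i * uPow i U * (((2 : ℝ) ^ m) ^ (2 * i) / ((2 : ℝ) ^ m) ^ 4) := by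
  have h := hS m hm i hi q
  rw [four_zpow_eq_two_pow_div] at h
  have hneg : (fun q : Momentum => -evalM (Kp m) q) = -evalM (Kp m) := rfl
  rwa [hneg, iteratedFDeriv_neg_apply, norm_neg]

/-! ## §3 The one-scale bound of the interpolated band `bₘ + s·(−Kₘ)` -/

/-- `Σ_{n ≤ m} Yₙ^{2i}/Yₙ⁴` for `i = 1, 2, 3`: `≤ 4/3`, `= m + 1 ≤ 2ᵐ`, `≤ (4/3)·4ᵐ`; in one-scale form `≤ cᵢ·(2ᵐ)ⁱ` with `c = (4/3, 1, 4/3)`. -/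
theorem sum_two_pow_scale_le {i : ℕ} (hi1 : 1 ≤ i) (hi3 : i ≤ 3) (m : ℕ) :
    ∑ n ∈ range (m + 1), ((2 : ℝ) ^ n) ^ (2 * i) / ((2 : ℝ) ^ n) ^ 4 ≤ 4 / 3 * ((2 : ℝ) ^ m) ^ i := by
  interval_cases i
  · -- `Σ (1/4)^n ≤ 4/3`
    have hterm : ∀ n : ℕ, ((2 : ℝ) ^ n) ^ (2 * 1) / ((2 : ℝ) ^ n) ^ 4 = (1 / 4 : ℝ) ^ n := fun n => by
      have h4 : ((2 : ℝ) ^ n) ^ 2 = (4 : ℝ) ^ n := by rw [← pow_mul, mul_comm, pow_mul]; norm_num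
      rw [show 2 * 1 = 2 by rfl, show ((2 : ℝ) ^ n) ^ 4 = (((2 : ℝ) ^ n) ^ 2) ^ 2 by ring, h4, one_div_pow]
      field_simp
    simp_rw [hterm]
    rw [geom_sum_eq (by norm_num) (m + 1)]
    have h1 : (1 : ℝ) ≤ (2 : ℝ) ^ m := one_le_pow₀ (by norm_num)
    have h2 : 0 ≤ (1 / 4 : ℝ) ^ (m + 1) := by positivity
    rw [pow_one]
    have : ((1 / 4 : ℝ) ^ (m + 1) - 1) / (1 / 4 - 1) = 4 / 3 * (1 - (1 / 4 : ℝ) ^ (m + 1)) := by field_simp; ring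
    rw [this]
    nlinarith
  · -- `Σ 1 = m + 1 ≤ (4/3)·4^m`
    have hterm : ∀ n : ℕ, ((2 : ℝ) ^ n) ^ (2 * 2) / ((2 : ℝ) ^ n) ^ 4 = 1 := fun n => by
      rw [show 2 * 2 = 4 by rfl, div_self (by positivity)]
    simp_rw [hterm]
    rw [sum_const, card_range, nsmul_eq_mul, mul_one]
    have h : ((m : ℝ) + 1) ≤ (2 : ℝ) ^ m := by
      have := Nat.lt_two_pow_self (n := m)
      exact_mod_cast this
    have h4 : ((2 : ℝ) ^ m) ^ 2 ≥ (2 : ℝ) ^ m := by nlinarith [one_le_pow₀ (by norm_num : (1 : ℝ) ≤ 2) (n := m)]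
    push_cast
    nlinarith
  · -- `Σ 4^n = (4^{m+1} - 1)/3 ≤ (4/3)·8^m`
    have hterm : ∀ n : ℕ, ((2 : ℝ) ^ n) ^ (2 * 3) / ((2 : ℝ) ^ n) ^ 4 = (4 : ℝ) ^ n := fun n => by
      have h4 : ((2 : ℝ) ^ n) ^ 2 = (4 : ℝ) ^ n := by rw [← pow_mul, mul_comm, pow_mul]; norm_num
      rw [show ((2 : ℝ) ^ n) ^ (2 * 3) = ((2 : ℝ) ^ n) ^ 4 * ((2 : ℝ) ^ n) ^ 2 by ring, h4]
      field_simp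
    simp_rw [hterm]
    rw [geom_sum_eq (by norm_num) (m + 1)]
    have h8 : (4 : ℝ) ^ m ≤ ((2 : ℝ) ^ m) ^ 3 := by
      rw [show (4 : ℝ) = 2 ^ 2 by norm_num, ← pow_mul, ← pow_mul]
      exact pow_le_pow_right₀ (by norm_num) (by omega)
    have : ((4 : ℝ) ^ (m + 1) - 1) / (4 - 1) ≤ 4 / 3 * (4 : ℝ) ^ m := by
      rw [pow_succ]; nlinarith [pow_pos (by norm_num : (0 : ℝ) < 4) m]
    nlinarith

/-- **The one-scale bound of the interpolated band**: under `FrameOK R U N μ K` with pieces `Kp`, `R.WF`, `|U| ≤ 1`, for `m ≤ N`,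
`s ∈ [0,1]` and `1 ≤ i ≤ 3`, `‖Dⁱ(bₘ + s·(−Kₘ))(q)‖ ≤ 4 + (4/3)·Gfr i·(2ᵐ)ⁱ ≤ (D_c·2ᵐ)ⁱ`, `D_c = 4 + (4/3)(Gfr 1 + Gfr 2 + Gfr 3)`. -/
theorem norm_iteratedFDeriv_frameBandInterp_le {R : RenConsts} (hRwf : R.WF) {U μ : ℝ} (hU1 : |U| ≤ 1) {N : ℕ}
    {Kp : ℕ → TrigPolyC4v}
    (hS : ∀ n ≤ N, ∀ j ≤ 4, ∀ q : Momentum, ‖iteratedFDeriv ℝ j (evalM (Kp n)) q‖ ≤ R.Gfr j * uPow j U * (4 : ℝ) ^ (((j : ℤ) - 2) * n))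
    {m : ℕ} (hm : m ≤ N) {s : ℝ} (hs : s ∈ Set.Icc (0 : ℝ) 1) {i : ℕ} (hi1 : 1 ≤ i) (hi3 : i ≤ 3) (q : Momentum) :
    ‖iteratedFDeriv ℝ i (fun q : Momentum => (frameLevel μ 0 q - ∑ n ∈ range m, evalM (Kp n) q) + s * -evalM (Kp m) q) q‖ ≤
      ((4 + 4 / 3 * (R.Gfr 1 + R.Gfr 2 + R.Gfr 3)) * (2 : ℝ) ^ m) ^ i := by
  have hG0 : ∀ j, 0 ≤ R.Gfr j := hRwf.2.2
  have hu : uPow i U ≤ 1 := by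
    unfold uPow
    split_ifs
    · exact hU1
    · nlinarith [abs_nonneg U, sq_abs U]
  have hu0 : 0 ≤ uPow i U := by unfold uPow; split_ifs <;> positivity
  -- split the function: `frameLevel μ 0 + ((-1) • Σ_{n<m} evalM (Kp n) + s • (-evalM (Kp m)))`
  have hfun : (fun q : Momentum => (frameLevel μ 0 q - ∑ n ∈ range m, evalM (Kp n) q) + s * -evalM (Kp m) q) =
      fun q : Momentum => frameLevel μ 0 q + ((-1 : ℝ) • ∑ n ∈ range m, evalM (Kp n) q + s • -evalM (Kp m) q) := by
    funext q; simp only [smul_eq_mul]; ring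
  have hcf : ContDiff ℝ i (frameLevel μ 0) := contDiff_frameLevel μ 0
  have hcs : ContDiff ℝ i (fun x : Momentum => ∑ n ∈ range m, evalM (Kp n) x) := ContDiff.sum fun n _ => contDiff_evalM (Kp n)
  have hcp : ContDiff ℝ i (fun q : Momentum => -evalM (Kp m) q) := contDiff_evalM_neg (Kp m)
  have hN : ContDiff ℝ i (fun x : Momentum => (-1 : ℝ) • ∑ n ∈ range m, evalM (Kp n) x) := hcs.const_smul _
  have hB : ContDiff ℝ i (fun x : Momentum => s • -evalM (Kp m) x) := hcp.const_smul s
  have hNB : ContDiff ℝ i (fun x : Momentum => (-1 : ℝ) • ∑ n ∈ range m, evalM (Kp n) x + s • -evalM (Kp m) x) := hN.add hB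
  rw [hfun, fun_iteratedFDeriv_add_apply hcf.contDiffAt hNB.contDiffAt, fun_iteratedFDeriv_add_apply hN.contDiffAt hB.contDiffAt,
    iteratedFDeriv_const_smul_apply' hcs.contDiffAt, iteratedFDeriv_const_smul_apply' hcp.contDiffAt,
    iteratedFDeriv_sum (fun n _ => contDiff_evalM (Kp n)), Finset.sum_apply]
  -- bound each part
  have hb0 := norm_iteratedFDeriv_frameLevel_zero_le μ hi1 q
  have hbn : ∀ n ∈ range m, ‖iteratedFDeriv ℝ i (evalM (Kp n)) q‖ ≤ R.Gfr i * (((2 : ℝ) ^ n) ^ (2 * i) / ((2 : ℝ) ^ n) ^ 4) := by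
    intro n hn
    have hn' : n ≤ N := (Nat.lt_succ_iff.1 (by have := mem_range.1 hn; omega)).trans hm
    have h := hS n hn' i (by omega) q
    rw [four_zpow_eq_two_pow_div] at h
    exact h.trans (by nlinarith [hG0 i, mul_le_mul_of_nonneg_left hu (hG0 i),
      show 0 ≤ ((2 : ℝ) ^ n) ^ (2 * i) / ((2 : ℝ) ^ n) ^ 4 by positivity])
  have hbm : ‖iteratedFDeriv ℝ i (fun q : Momentum => -evalM (Kp m) q) q‖ ≤ R.Gfr i * (((2 : ℝ) ^ m) ^ (2 * i) / ((2 : ℝ) ^ m) ^ 4) := by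
    have h := norm_iteratedFDeriv_framePiece_le hS hm (i := i) (by omega) q
    exact h.trans (by nlinarith [hG0 i, mul_le_mul_of_nonneg_left hu (hG0 i),
      show 0 ≤ ((2 : ℝ) ^ m) ^ (2 * i) / ((2 : ℝ) ^ m) ^ 4 by positivity])
  have hsum_le : ‖∑ n ∈ range m, iteratedFDeriv ℝ i (evalM (Kp n)) q‖ + ‖s • iteratedFDeriv ℝ i (fun q : Momentum => -evalM (Kp m) q) q‖ ≤
      R.Gfr i * ∑ n ∈ range (m + 1), ((2 : ℝ) ^ n) ^ (2 * i) / ((2 : ℝ) ^ n) ^ 4 := by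
    rw [sum_range_succ, mul_add, mul_sum]
    refine add_le_add ((norm_sum_le _ _).trans (sum_le_sum hbn)) ?_
    rw [norm_smul, Real.norm_eq_abs, abs_of_nonneg hs.1]
    calc s * ‖iteratedFDeriv ℝ i (fun q : Momentum => -evalM (Kp m) q) q‖ ≤ 1 * (R.Gfr i * (((2 : ℝ) ^ m) ^ (2 * i) / ((2 : ℝ) ^ m) ^ 4)) :=
          mul_le_mul hs.2 hbm (norm_nonneg _) zero_le_one
      _ = _ := one_mul _
  have hgeo := sum_two_pow_scale_le hi1 hi3 m
  have hGi : R.Gfr i ≤ R.Gfr 1 + R.Gfr 2 + R.Gfr 3 := by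
    interval_cases i
    · linarith [hG0 2, hG0 3]
    · linarith [hG0 1, hG0 3]
    · linarith [hG0 1, hG0 2]
  have hY1 : (1 : ℝ) ≤ (2 : ℝ) ^ m := one_le_pow₀ (by norm_num)
  have hYi : (2 : ℝ) ^ m ≤ ((2 : ℝ) ^ m) ^ i := by
    calc (2 : ℝ) ^ m = ((2 : ℝ) ^ m) ^ 1 := (pow_one _).symm
      _ ≤ ((2 : ℝ) ^ m) ^ i := pow_le_pow_right₀ hY1 hi1
  set Dc : ℝ := 4 + 4 / 3 * (R.Gfr 1 + R.Gfr 2 + R.Gfr 3) with hDc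
  have hDc4 : 4 ≤ Dc := by rw [hDc]; nlinarith [hG0 1, hG0 2, hG0 3]
  have hDci : Dc ≤ Dc ^ i := by
    calc Dc = Dc ^ 1 := (pow_one _).symm
      _ ≤ Dc ^ i := pow_le_pow_right₀ (by linarith) hi1
  have hneg1 : ‖(-1 : ℝ) • ∑ n ∈ range m, iteratedFDeriv ℝ i (evalM (Kp n)) q‖ = ‖∑ n ∈ range m, iteratedFDeriv ℝ i (evalM (Kp n)) q‖ := by
    rw [neg_one_smul, norm_neg]
  calc _ ≤ ‖iteratedFDeriv ℝ i (frameLevel μ 0) q‖ +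
        ‖(-1 : ℝ) • ∑ n ∈ range m, iteratedFDeriv ℝ i (evalM (Kp n)) q + s • iteratedFDeriv ℝ i (fun q : Momentum => -evalM (Kp m) q) q‖ :=
        norm_add_le _ _
    _ ≤ ‖iteratedFDeriv ℝ i (frameLevel μ 0) q‖ + (‖∑ n ∈ range m, iteratedFDeriv ℝ i (evalM (Kp n)) q‖ +
        ‖s • iteratedFDeriv ℝ i (fun q : Momentum => -evalM (Kp m) q) q‖) := by
        rw [← hneg1]; exact add_le_add le_rfl (norm_add_le _ _)
    _ ≤ 4 + R.Gfr i * ∑ n ∈ range (m + 1), ((2 : ℝ) ^ n) ^ (2 * i) / ((2 : ℝ) ^ n) ^ 4 := by linarith [hsum_le, hb0]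
    _ ≤ 4 + R.Gfr i * (4 / 3 * ((2 : ℝ) ^ m) ^ i) := by nlinarith [hG0 i, hgeo]
    _ ≤ (4 + 4 / 3 * (R.Gfr 1 + R.Gfr 2 + R.Gfr 3)) * ((2 : ℝ) ^ m) ^ i := by
        have h1 : (1 : ℝ) ≤ ((2 : ℝ) ^ m) ^ i := hY1.trans hYi
        nlinarith [hG0 i, hGi, h1, hG0 1, hG0 2, hG0 3]
    _ ≤ (Dc * (2 : ℝ) ^ m) ^ i := by
        rw [mul_pow, ← hDc]
        exact mul_le_mul_of_nonneg_right hDci (by positivity)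

end Summit.HubbardSuperconductivity.HubbardSuperconductivity.Theorems.EngineV8

end
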